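import Summits.NavierStokesRegularity.FunctionalMining.Candidates
import Literature.Analysis.FluidPDE.TorusVorticityMomentBalance
import Literature.Analysis.FluidPDE.TorusVorticityRealMomentBalance
import Literature.Analysis.FluidPDE.TorusWeightedVorticityBalanceC1
import Literature.Analysis.FluidPDE.TorusNSSmoothLocalExistence
import HarnessLib

/-!
(Part 1/2 — §§ 1–5; §§ 6–7 are in `FunctionalMining/MiddleEigenvalueMomentDoorReal.lean`; split by the prove seat for the 400-line cap, text verbatim.)
# FunctionalMining — K1-Q2 door: the middle-eigenvalue moment law is EQUIVALENT to a static
# inequality over divergence-free fields (dict seat, staged)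

Search for candidate a priori estimates; no regularity claim.

STAGED FILE (planner/dict seat cannot file under `FunctionalMining/`; proposed tree name
`FunctionalMining/MiddleEigenvalueMomentDoor.lean`, prove-seat queue item (l)). Imports ONLY tree
modules: `Candidates.lean` (p198575: `torusVorticityMoment q = Z_q = ∫|ω|^q`,
`MiddleEigenvalueMomentRateBound q C` = the typed K1-Q2 law, `middleEigenvalueMomentRateBound_two`),
the literature seat's Gibbon moment balance `TorusVorticityMomentBalance.lean` (p203369:
`IsClassicalNSSolutionOn.hasDerivWithinAt_integral_torusVorticitySqAt_pow` — the exact one-sided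
derivative of `∫|ω|^{2m}` along classical NS on `T^d`, Gibbon 2010 App. A — and its unforced
corollary `…deriv_integral_torusVorticitySqAt_pow_le : R ≤ 2m∫|ω|^{2(m−1)}σ`), and smooth-data local
existence for Euler/NS on the torus `Torus.exists_classicalNS_smooth` (Majda–Bertozzi Thm 3.4,
`ν ≥ 0`). Staged 2026-08-20 by planner-pub-nsfunc-dict-g6-0 (cell `pub-nsfunc`, dictionary seat).

THE DOOR. DICTIONARY §14 row D2a / K1-Q2 asks, for the vorticity moments `Z_q = ∫|ω|^q` with
`q ≠ 2`, whether `dZ_q/dt ≤ C·‖λ₂⁺(S)‖_∞·Z_q` holds a priori along classical solutions on `T³`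
(`MiddleEigenvalueMomentRateBound q C`; at `q = 2` it holds with `C = 2`, Betchov + Miller L5.1,
PROVED in the tree). NOGO N2 says such sup-rate rows are decided by STATIC field ascent. This file
makes that literal for the even moments `q = 2m`, `m ∈ ℕ`, `m ≥ 1`:

* `MiddleEigenvalueStretchingStatic m C` — the static inequality
  `2m ∫ |ω|^{2(m−1)} σ ≤ C · Λ · ∫ |ω|^{2m}` for every smooth divergence-free `v` on `T³` and every
  `Λ ≥ 0` dominating the middle strain eigenvalue pointwise (`σ = torusStretchingDensity v = ωᵀSω`
  for div-free fields on `T³`, `torusStretchingDensity_fin_three_of_isDivFree`);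
* `middleEigenvalueMomentRateBound_of_static` (static ⇒ dynamic, `m ≥ 1`): by the unforced Gibbon
  inequality `R ≤ 2m∫|ω|^{2(m−1)}σ` (viscous term dropped, `ν ≥ 0`);
* `MiddleEigenvalueMomentRateBound.static_evenMoment` (dynamic ⇒ static, every `m`): run the law
  along the local classical EULER solution (`ν = 0`, Majda–Bertozzi Thm 3.4) issued from `v` and read
  the exact derivative of `∫|ω|^{2m}` at `t = 0`, where the viscous and forcing terms vanish;
* `middleEigenvalueMomentRateBound_iff_static` — the equivalence for `m ≥ 1`;
* `not_middleEigenvalueMomentRateBound_of_static_violation` — NO-GO CRITERION: one smooth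
  divergence-free field with `2m∫|ω|^{2(m−1)}σ > CΛ∫|ω|^{2m}` for an admissible `Λ` refutes the law
  at `(2m, C)`; with `Λ = 0` admissible (`λ₂(S) ≤ 0` everywhere) and `∫|ω|^{2(m−1)}σ > 0` it refutes
  EVERY `C` at once (`middleEigenvalueMomentRateFails_of_nonpos_middle`);
* `middleEigenvalueStretchingStatic_one` — calibration: the static Betchov–Miller inequality
  `2∫σ ≤ 2Λ∫|ω|²` on `T³`, obtained from the tree's dynamic `q = 2` theorem through the door.

Scope (honest): even integer moments only (`Z_{2m} = ∫ (|ω|²)^m` is a polynomial weight, so the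
tree's `C^∞`-weight balance applies); odd / fractional `q` would need the weighted balance for
`Φ(s) = s^{q/2}`, which is not smooth at `s = 0`. Nothing here is a regularity statement: these are
a priori differential inequalities and their static equivalents.

**v3 (§ 7): the door for EVERY REAL exponent `q ≥ 2`.** With the literature seat's `C¹`-weight
vorticity balance (`IsClassicalNSSolutionOn.hasDerivWithinAt_integral_torusVorticitySqAt_rpow_euler`,
exact `d/dt Z_q = q∫(|ω|²)^{q/2−1}σ` along Euler, p204166, and Gibbon's unforced inequality
`deriv_integral_torusVorticitySqAt_rpow_le_of_two_le` for `ν ≥ 0`, p203993; Gibbon 2010 App. A) the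
even-moment restriction disappears: `MiddleEigenvalueStretchingStaticReal q C` (static form,
`q∫(|ω|²)^{q/2−1}σ ≤ CΛ Z_q`) satisfies `MiddleEigenvalueMomentRateBound q C ↔
MiddleEigenvalueStretchingStaticReal q C` for every real `q ≥ 2`
(`middleEigenvalueMomentRateBound_iff_staticReal`), with the no-go criterion
`not_middleEigenvalueMomentRateBound_of_staticReal_violation`, the kill-all form
`middleEigenvalueMomentRateFailsReal_of_nonpos_middle`, consistency with §§ 2–4 at `q = 2m`
(`middleEigenvalueStretchingStaticReal_iff_even`), the calibration `q = 2, C = 2`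
(`middleEigenvalueStretchingStaticReal_two`) and the 2.5D structural zero for real weights
(`weightedStretchingReal_nonpos_of_vertical`). This covers the K0 rows `E.q|T_C|C3b` for
`q ∈ {5/2, 3, 10/3, 4, 5, 6}`; `q = 3/2` (weight `(|ω|²)^{−1/4}`) stays outside the door.
-/

noncomputable section

open Set MeasureTheory Finset
open scoped InnerProductSpace RealInnerProductSpace

namespace Summit.NavierStokesRegularity.FunctionalMining

open Literature.Analysis Literature.Analysis.FunctionSpaces Literature.Analysis.FunctionSpaces.Torus
  Literature.Analysis.FluidPDE

variable {d : Type*} [Fintype d] [DecidableEq d]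

/-! ## 1. Even moments: `Z_{2m} = ∫ (|ω|²)^m` -/

/-- `Z_{2m}(v) = ∫ (torusVorticitySqAt v x)^m` with a natural-number power (`(s)^{(2m)/2} = s^m`
for `s ≥ 0`, indeed for all real `s` by `Real.rpow_natCast`). [folklore] -/
theorem torusVorticityMoment_two_mul_natCast (m : ℕ) (v : UnitAddTorus d → EuclideanSpace ℝ d) :
    torusVorticityMoment (2 * m) v = ∫ x, torusVorticitySqAt v x ^ m := by
  unfold torusVorticityMoment
  refine integral_congr_ae (ae_of_all _ fun x => ?_)
  simp only
  rw [show (2 * (m : ℝ)) / 2 = (m : ℝ) by ring, Real.rpow_natCast]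

/-- The same identity for time-dependent fields, as an equality of functions of time. [folklore] -/
theorem torusVorticityMoment_two_mul_natCast_fun (m : ℕ)
    (u : ℝ → UnitAddTorus d → EuclideanSpace ℝ d) :
    (fun s => torusVorticityMoment (2 * m) (u s)) = fun s => ∫ x, torusVorticitySqAt (u s) x ^ m :=
  funext fun s => torusVorticityMoment_two_mul_natCast m (u s)

/-! ## 2. The static form of K1-Q2 at `q = 2m` -/

/-- **Static middle-eigenvalue stretching inequality (K1-Q2 at `q = 2m`, static form).** For every
smooth divergence-free `v` on `T³` and every `Λ ≥ 0` with `λ₂(S(x)) ≤ Λ` for all `x` (middle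
eigenvalue of the strain `Sᵢⱼ = ½((∂ⱼv)ᵢ + (∂ᵢv)ⱼ)`, Mathlib's decreasing `eigenvalues₀`, index `1` of
`3`, exactly as in `MiddleEigenvalueMomentRateBound`):
`2m ∫ |ω|^{2(m−1)} σ ≤ C · Λ · ∫ |ω|^{2m}`, `σ = torusStretchingDensity v` (`= ωᵀSω` here). The
quantity a static field ascent (NOGO N2) maximises is `2m∫|ω|^{2(m−1)}σ / (Λ ∫|ω|^{2m})`. A static
inequality between integrals of one field — search for candidate a priori estimates; no regularity
claim; nothing is asserted. [ours; typing] -/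
@[conjecture] def MiddleEigenvalueStretchingStatic (m : ℕ) (C : ℝ) : Prop :=
  ∀ hd : Fintype.card d = 3, ∀ v : UnitAddTorus d → EuclideanSpace ℝ d,
    Torus.IsSmooth v → Torus.IsDivFree v → ∀ Λ : ℝ, 0 ≤ Λ →
      (∀ x, ∀ hx : (Matrix.of fun i j =>
          (Torus.partialDeriv j v x i + Torus.partialDeriv i v x j) / 2).IsHermitian,
          hx.eigenvalues₀ (Fin.cast hd.symm 1) ≤ Λ) →
      2 * m * ∫ x, torusVorticitySqAt v x ^ (m - 1) * torusStretchingDensity v x ≤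
        C * Λ * ∫ x, torusVorticitySqAt v x ^ m

/-- Monotonicity of the static form in the constant. [ours; elementary] -/
theorem MiddleEigenvalueStretchingStatic.mono {m : ℕ} {C C' : ℝ}
    (h : MiddleEigenvalueStretchingStatic (d := d) m C) (hCC' : C ≤ C') :
    MiddleEigenvalueStretchingStatic (d := d) m C' := by
  intro hd v hv hdiv Λ hΛ0 hΛ
  have hZ : 0 ≤ ∫ x, torusVorticitySqAt v x ^ m :=
    integral_nonneg fun x => pow_nonneg (torusVorticitySqAt_nonneg v x) m
  exact (h hd v hv hdiv Λ hΛ0 hΛ).trans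
    (mul_le_mul_of_nonneg_right (mul_le_mul_of_nonneg_right hCC' hΛ0) hZ)

/-! ## 3. Static ⇒ dynamic (Gibbon's unforced moment inequality) -/

/-- **K1-Q2 door, forward: static ⇒ dynamic.** If the static inequality holds at `(m, C)` with
`m ≥ 1`, then the middle-eigenvalue moment law `MiddleEigenvalueMomentRateBound (2m) C` holds along
every classical solution of unforced Navier–Stokes/Euler (`ν ≥ 0`) on `T³`: every one-sided
derivative `R` of `Z_{2m}` obeys `R ≤ 2m∫|ω|^{2(m−1)}σ` (Gibbon 2010 App. A with the nonpositive
viscous term dropped; tree p203369) `≤ CΛZ_{2m}` (static form at the time slice). Search for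
candidate a priori estimates; no regularity claim. [ours] -/
theorem middleEigenvalueMomentRateBound_of_static {m : ℕ} (hm : 1 ≤ m) {C : ℝ}
    (h : MiddleEigenvalueStretchingStatic (d := d) m C) :
    MiddleEigenvalueMomentRateBound (d := d) (2 * m) C := by
  intro hd ν hν a b hab u p hsol t ht Λ hΛ0 hΛ R hR
  rw [torusVorticityMoment_two_mul_natCast_fun m u] at hR
  have hle := hsol.deriv_integral_torusVorticitySqAt_pow_le hν hab hm ht hR
  have hst := h hd (u t) (hsol.smooth_velocity.isSmooth_slice ht) (hsol.divFree t ht) Λ hΛ0 hΛ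
  rw [torusVorticityMoment_two_mul_natCast]
  exact hle.trans hst

/-! ## 4. Dynamic ⇒ static (local Euler solution from the field, exact derivative at `t = 0`) -/

/-- In the unforced case the forcing term of the moment balance vanishes pointwise. [folklore] -/
theorem sum_torusVorticityTensor_mul_curl_zero (v : UnitAddTorus d → EuclideanSpace ℝ d)
    (t : ℝ) (x : UnitAddTorus d) :
    ∑ i, ∑ j, torusVorticityTensor v i j x *
      (Torus.partialDeriv i ((0 : ℝ → UnitAddTorus d → EuclideanSpace ℝ d) t) x j -
        Torus.partialDeriv j ((0 : ℝ → UnitAddTorus d → EuclideanSpace ℝ d) t) x i) = 0 := by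
  have h0 : ∀ i, Torus.partialDeriv i (0 : UnitAddTorus d → EuclideanSpace ℝ d) x = 0 := by
    intro i
    simp [Torus.partialDeriv, Torus.lineDeriv]
  simp [h0]

/-- **K1-Q2 door, backward: dynamic ⇒ static** (every `m`). If `MiddleEigenvalueMomentRateBound (2m) C`
holds, then so does the static inequality: given a smooth divergence-free `v`, run the local classical
EULER solution from `v` (`ν = 0`, `Torus.exists_classicalNS_smooth`, Majda–Bertozzi Thm 3.4); at
`t = 0` the exact derivative of `Z_{2m}` (tree p203369) is `2m∫|ω|^{2(m−1)}σ(v)` (no viscous term,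
no forcing), and the law bounds it by `CΛZ_{2m}(v)`. Search for candidate a priori estimates; no
regularity claim. [ours] -/
theorem MiddleEigenvalueMomentRateBound.static_evenMoment {m : ℕ} {C : ℝ}
    (h : MiddleEigenvalueMomentRateBound (d := d) (2 * m) C) :
    MiddleEigenvalueStretchingStatic (d := d) m C := by
  intro hd v hv hdiv Λ hΛ0 hΛ
  obtain ⟨T, hT, u, p, hsol, hu0, -⟩ := Torus.exists_classicalNS_smooth (d := d) hd.le le_rfl hv hdiv
  have h0 : (0 : ℝ) ∈ Icc 0 T := left_mem_Icc.2 hT.le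
  have hder := hsol.hasDerivWithinAt_integral_torusVorticitySqAt_pow hT m h0
  have hder2 : HasDerivWithinAt (fun s => ∫ x, torusVorticitySqAt (u s) x ^ m)
      (2 * m * ∫ x, torusVorticitySqAt (u 0) x ^ (m - 1) * torusStretchingDensity (u 0) x)
      (Icc 0 T) 0 := by
    convert hder using 1
    simp only [sum_torusVorticityTensor_mul_curl_zero, mul_zero, integral_zero, zero_mul, sub_zero,
      add_zero]
  rw [← torusVorticityMoment_two_mul_natCast_fun m u] at hder2
  have hΛ' : ∀ x, ∀ hx : (Matrix.of fun i j =>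
      (Torus.partialDeriv j (u 0) x i + Torus.partialDeriv i (u 0) x j) / 2).IsHermitian,
      hx.eigenvalues₀ (Fin.cast hd.symm 1) ≤ Λ := by
    rw [hu0]
    exact hΛ
  have hle := h hd le_rfl hT hsol 0 h0 Λ hΛ0 hΛ' _ hder2
  rw [torusVorticityMoment_two_mul_natCast, hu0] at hle
  exact hle

/-- **The K1-Q2 door (even moments): dynamic law ⇔ static inequality**, `m ≥ 1`. Search for candidate
a priori estimates; no regularity claim. [ours] -/
theorem middleEigenvalueMomentRateBound_iff_static {m : ℕ} (hm : 1 ≤ m) {C : ℝ} :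
    MiddleEigenvalueMomentRateBound (d := d) (2 * m) C ↔ MiddleEigenvalueStretchingStatic (d := d) m C :=
  ⟨fun h => h.static_evenMoment, fun h => middleEigenvalueMomentRateBound_of_static hm h⟩

/-! ## 5. No-go criterion and calibration -/

/-- **NO-GO CRITERION for K1-Q2 at `q = 2m`.** One smooth divergence-free field `v` on `T³`, one
admissible `Λ ≥ 0` (`λ₂(S(x)) ≤ Λ` everywhere) and the strict violation
`C·Λ·∫|ω|^{2m} < 2m∫|ω|^{2(m−1)}σ` refute `MiddleEigenvalueMomentRateBound (2m) C`. This is the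
exact-lane / census door for the K0 rows `E.q≠2|T_C|C3b` with even `q`: a certificate is a field plus
two integrals and a pointwise eigenvalue bound. Search for candidate a priori estimates; no regularity
claim. [ours] -/
theorem not_middleEigenvalueMomentRateBound_of_static_violation {m : ℕ} {C : ℝ}
    (hd : Fintype.card d = 3) {v : UnitAddTorus d → EuclideanSpace ℝ d} (hv : Torus.IsSmooth v)
    (hdiv : Torus.IsDivFree v) {Λ : ℝ} (hΛ0 : 0 ≤ Λ)
    (hΛ : ∀ x, ∀ hx : (Matrix.of fun i j =>
        (Torus.partialDeriv j v x i + Torus.partialDeriv i v x j) / 2).IsHermitian,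
        hx.eigenvalues₀ (Fin.cast hd.symm 1) ≤ Λ)
    (hviol : C * Λ * ∫ x, torusVorticitySqAt v x ^ m <
      2 * m * ∫ x, torusVorticitySqAt v x ^ (m - 1) * torusStretchingDensity v x) :
    ¬ MiddleEigenvalueMomentRateBound (d := d) (2 * m) C := fun h =>
  absurd (h.static_evenMoment hd v hv hdiv Λ hΛ0 hΛ) (not_le.mpr hviol)

/-- **Refutation of EVERY constant at once.** A smooth divergence-free field on `T³` whose middle
strain eigenvalue is `≤ 0` everywhere (`Λ = 0` admissible) and whose weighted stretching
`∫|ω|^{2(m−1)}σ` is positive refutes `MiddleEigenvalueMomentRateBound (2m) C` for every `C`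
(at `m = 1` no such field exists: `∫σ = −4∫λ₁λ₂λ₃ ≤ 0` when `λ₂ ≤ 0`, Betchov). The target the
no-go seat's static ascent should aim at for `q = 4, 6, …`. Search for candidate a priori estimates;
no regularity claim. [ours] -/
theorem middleEigenvalueMomentRateFails_of_nonpos_middle {m : ℕ} (hd : Fintype.card d = 3)
    {v : UnitAddTorus d → EuclideanSpace ℝ d} (hv : Torus.IsSmooth v) (hdiv : Torus.IsDivFree v)
    (hΛ : ∀ x, ∀ hx : (Matrix.of fun i j =>
        (Torus.partialDeriv j v x i + Torus.partialDeriv i v x j) / 2).IsHermitian,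
        hx.eigenvalues₀ (Fin.cast hd.symm 1) ≤ 0)
    (hpos : 0 < 2 * m * ∫ x, torusVorticitySqAt v x ^ (m - 1) * torusStretchingDensity v x) :
    ∀ C : ℝ, ¬ MiddleEigenvalueMomentRateBound (d := d) (2 * m) C := fun C =>
  not_middleEigenvalueMomentRateBound_of_static_violation hd hv hdiv le_rfl hΛ (by simpa using hpos)

/-- **Calibration through the door: the STATIC Betchov–Miller inequality on `T³`** —
`2∫σ ≤ 2Λ∫|ω|²` for every smooth divergence-free `v` and every pointwise bound `Λ ≥ 0` on the middle
strain eigenvalue — obtained from the tree's dynamic `q = 2` theorem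
`middleEigenvalueMomentRateBound_two` (Miller L5.1, lit p195623) by `static_evenMoment` at `m = 1`.
[folklore; ours as a corollary] -/
theorem middleEigenvalueStretchingStatic_one : MiddleEigenvalueStretchingStatic (d := d) 1 2 := by
  have e : ((2 : ℝ) * ((1 : ℕ) : ℝ)) = 2 := by norm_num
  have h' : MiddleEigenvalueMomentRateBound (d := d) (2 * ((1 : ℕ) : ℝ)) 2 := by
    rw [e]
    exact middleEigenvalueMomentRateBound_two
  exact h'.static_evenMoment

end Summit.NavierStokesRegularity.FunctionalMining

end
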